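import Mathlib.Analysis.SpecialFunctions.Trigonometric.Deriv
import Literature.MathematicalPhysics.QuantumFieldTheory.Balaban1983to89.T4GenFunBounds

/-!
# YM-DAG node N19 (= NE7 proper) — THE EXPECTATION CURRENCY OF THE NODE's DECL TARGET, I: LANDAU's INEQUALITY AT THE CENTRE OF A
# SYMMETRIC WINDOW; matched increments of two `C²` functions with second derivatives in `[0, V]` ⇒ matched derivatives at the price √;
# the same for two cumulant generating functions of bounded variables; the price √ is attained (kernel guard)

Cell `pub-ymgap`, HUMAN RULING D-0062 (Track A), R141 (C) wider-strategy seat `pub-ymgap-dag-n19-e` (strategy s3 = ALTERNATIVE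
CURRENCY), fourth delivery of the seat's row (after `…Theorems.BalabanUVNodesN19BudgetRoad` p453434 — Σδ_K REDUCED to «weights summable +
margin window»; `…N19CoreMetric` p462782 — `Core` read intrinsically; `…N19SourceSplit` ∕ `…SourceSplitGuards` p468320 ∕ p468563 — the source
split of `Core`).  Route `Summits/QuantumFields/YangMills/Theses/BalabanUVNodes.lean` rev 15, cluster item K3′ «SpineGivenEndpointR12»
(stmt-QuantumFields-19908); filed `--supports` that item `--as helper` (it proves no registered stub).  This is the ANALYSIS module; the
sibling `…Theorems.BalabanUVNodesN19ExpectationCurrencyAtScheme` (filed right after) applies it to N19's DECL target at the scheme.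
COUNT-NEUTRAL: elementary real analysis (Landau 1913) + Mathlib's calculus of the cumulant generating function; NOT a discharge claim.

THE QUESTION.  N19's DECL target is `Spine.NE7.Target vol l₀ δ Z` = `T4CauchySum.MatchingModConstants vol l₀ δ Z ∧ Summable δ`
(`Spine/NE7/Targets.lean` :63): consecutive dressed partition functions match modulo `t`-independent constants, so the generating functions
`G_K(t) = log Z_K(t) − log Z_K(0)` have increments `|G_{K+1}(t) − G_K(t)| ≤ 2·vol·δ_K` on `|t| ≤ l₀` (`T4CauchySum.abs_genFun_succ_sub_le`).
The apex consumes this through node U0 (`T4Assembly`) and the VITALI step (`T4VitaliStep` ∕ `T4GenFunConverse`: genFun convergent ⇔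
expectations convergent) — a QUALITATIVE road with NO RATE.  The apex's other socket is the observable currency
`T4VarianceMatching.ExpectCauchyRate S δ'` (`|⟨∏os⟩_{K+1} − ⟨∏os⟩_K| ≤ C_os·δ'_K`), fed in the tree only by law-level producers (transport ∕
path variance: `T4PathVarianceRate`, `T4ApexVariance` §2–§8; the converse `ExpectCauchyRate ⇒ GenFunCauchy` is
`T4ApexVariance.genFunCauchy_of_expectCauchyRate`).  WHICH OBSERVABLE RATE DOES N19's TARGET ITSELF PAY, with no law-level input?  `√δ_K`.

THE MECHANISM [folklore; E. Landau, Proc. London Math. Soc. (2) 13 (1913) 43–49 — the interval form `‖h′‖ ≤ 2‖h‖∕ℓ + ℓ‖h″‖∕2`; the tree holds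
the normed-space ball form in `Literature.Analysis.Calculus.DerivativeInterpolation`, not this scalar symmetric-window form].  For
`h = G_{K+1} − G_K` on `[−l₀, l₀]`: `h(0) = 0`, `|h| ≤ η := 2·vol·δ_K`, `h′(0) = ⟨F⟩_{K+1} − ⟨F⟩_K`, and `h″ = G″_{K+1} − G″_K` is a DIFFERENCE OF
TWO TILTED VARIANCES of an observable bounded by `B` (Mathlib `iteratedDeriv_two_cgf_eq_integral`), each in `[0, B²]` — so `|h″| ≤ B²` for free,
with NO smallness.  Second-order Taylor at `±l` and subtraction kill the centre value and the even part: `|h′(0)| ≤ η∕l + B²·l∕2` for every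
window `0 < l ≤ l₀`; optimising the window, `|h′(0)| ≤ 2η∕l₀ + √(2ηB²)`.

WHAT IS KERNEL-CHECKED HERE (0 `def`, 0 `sorry`; all [folklore]).
* §1 LANDAU AT THE CENTRE OF A SYMMETRIC WINDOW: `taylor_two_upper` · `taylor_two_lower` (one-sided second-order Taylor bounds from a one-sided
  Lipschitz bound on the derivative, by monotonicity — Mathlib `antitoneOn_of_hasDerivWithinAt_nonpos` ∕ `monotoneOn_of_hasDerivWithinAt_nonneg`)
  · `abs_taylor_two_centre_le` · `abs_deriv_centre_le` (`|h′ 0| ≤ η∕l + M·l∕2`) · `window_optimum` (the arithmetic of the optimal window) ·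
  `abs_deriv_centre_le_sqrt` (`|h′ 0| ≤ 2η∕l + √(2ηM)`).
* §2 TWO `C²` FUNCTIONS WITH SECOND DERIVATIVES IN `[0, V]` AND MATCHED INCREMENTS: `abs_sub_deriv_le_of_matched_increments`
  (`|g′ 0 − f′ 0| ≤ 2η∕l + √(2ηV)`; Mathlib `Convex.norm_image_sub_le_of_norm_hasDerivWithin_le` for the Lipschitz step).
* §3 AT MATHLIB's CUMULANT GENERATING FUNCTION (`ProbabilityTheory.cgf`, bounded variable, probability measure; tree
  `T4GenFunBounds.analyticAt_cgf_of_abs_le` ∕ `differentiable_cgf_of_abs_le` ∕ `mem_interior_integrableExpSet` BY NAME):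
  `iteratedDeriv_two_cgf_mem_Icc` (`0 ≤ cgf″ ≤ B²`) · `hasDerivAt_deriv_cgf` · `abs_sub_deriv_cgf_zero_le` (two bounded variables on two spaces
  whose normalised cgfs have matched increments on `[−l, l]` ⇒ their means differ by `≤ 2η∕l + √(2ηB²)`).
* §4 THE PRICE √ IS NOT AN ARTEFACT OF THE PROOF (kernel guard for the §2 class): `sqrt_price_witness` — for `0 < η`, `0 < M` the pair
  `f t = M·t²∕4 − (η∕2)·sin(ω t)`, `g t = M·t²∕4 + (η∕2)·sin(ω t)`, `ω = √(M∕η)`, has second derivatives in `[0, M]`, matched increments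
  `|(g t − g 0) − (f t − f 0)| ≤ η` on EVERY window, and `g′ 0 − f′ 0 = √(ηM)`: within the factor `√2` of §2's bound as `l → ∞`.  A LINEAR
  price needs complex-variable input (both cgfs are analytic and bounded on a complex disc where the mgf has no zero; a two-constants
  estimate would give `η^{1−ε}`) — NOT attempted here and NOT claimed.

HONEST FRAMING.  Pure analysis; no lattice gauge theory in this file beyond Mathlib's `cgf`.  NE7 ∕ NE7b ∕ NE7c are NOT PRINTED
([Balaban1987RG1]–[Balaban1989LargeFieldII] bound ONE run uniformly in `ε`) and NOT PROVED; nothing of Bałaban's is asserted or instantiated;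
N19 is NOT discharged; Track A count unmoved (A 5∕28).  One finite four-torus at fixed ε, rung (B)+1 — NOT infinite volume, NOT OS on ℝ⁴, NOT a
mass gap, NOT Clay.  THEOREMS ONLY; 0 sorry; standard axioms.  No decl below carries a cite tag.
-/

set_option autoImplicit false

noncomputable section

open Set Filter Topology MeasureTheory ProbabilityTheory
open scoped BigOperators

namespace Summit.QuantumFields.YangMills.BalabanUVNodes.N19ExpectationCurrency

open Literature.MathematicalPhysics.QuantumFieldTheory.Balaban1983to89

/-! ## §1 Landau's inequality at the centre of a symmetric window [folklore] -/

section Landau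

variable {h h' : ℝ → ℝ} {η M l : ℝ}

/-- One-sided second-order Taylor bound: if `h` has derivative `h'` on `[0, l]` and `h' s − h' 0 ≤ M·s` there, then
`h l − h 0 − l·h' 0 ≤ M·l²∕2` (the function `s ↦ h s − s·h' 0 − M·s²∕2` is antitone on `[0, l]`). [folklore] -/
theorem taylor_two_upper (hl : 0 ≤ l) (hd : ∀ s ∈ Icc (0 : ℝ) l, HasDerivAt h (h' s) s)
    (hLip : ∀ s ∈ Icc (0 : ℝ) l, h' s - h' 0 ≤ M * s) : h l - h 0 - l * h' 0 ≤ M * l ^ 2 / 2 := by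
  have hgd : ∀ s ∈ Icc (0 : ℝ) l,
      HasDerivAt (fun s => h s - s * h' 0 - M * s ^ 2 / 2) (h' s - h' 0 - M * s) s := by
    intro s hs
    have h1 : HasDerivAt (fun s : ℝ => s * h' 0) (h' 0) s := by
      simpa using (hasDerivAt_id s).mul_const (h' 0)
    have h2 : HasDerivAt (fun s : ℝ => M * s ^ 2 / 2) (M * s) s := by
      have h2' : HasDerivAt (fun s : ℝ => s ^ 2) (2 * s) s := by simpa using hasDerivAt_pow 2 s
      exact ((h2'.const_mul M).div_const 2).congr_deriv (by ring)
    exact ((hd s hs).sub h1).sub h2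
  have hanti : AntitoneOn (fun s => h s - s * h' 0 - M * s ^ 2 / 2) (Icc 0 l) :=
    antitoneOn_of_hasDerivWithinAt_nonpos (convex_Icc 0 l)
      (fun s hs => (hgd s hs).continuousAt.continuousWithinAt)
      (fun s hs => (hgd s (interior_subset hs)).hasDerivWithinAt)
      (fun s hs => by
        rw [interior_Icc] at hs
        have := hLip s (Ioo_subset_Icc_self hs)
        linarith)
  have key := hanti (left_mem_Icc.mpr hl) (right_mem_Icc.mpr hl) hl
  simp only at key
  norm_num at key
  linarith

/-- The lower companion: `−M·s ≤ h' s − h' 0` on `[0, l]` gives `−M·l²∕2 ≤ h l − h 0 − l·h' 0`. [folklore] -/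
theorem taylor_two_lower (hl : 0 ≤ l) (hd : ∀ s ∈ Icc (0 : ℝ) l, HasDerivAt h (h' s) s)
    (hLip : ∀ s ∈ Icc (0 : ℝ) l, -(M * s) ≤ h' s - h' 0) : -(M * l ^ 2 / 2) ≤ h l - h 0 - l * h' 0 := by
  have hgd : ∀ s ∈ Icc (0 : ℝ) l,
      HasDerivAt (fun s => h s - s * h' 0 + M * s ^ 2 / 2) (h' s - h' 0 + M * s) s := by
    intro s hs
    have h1 : HasDerivAt (fun s : ℝ => s * h' 0) (h' 0) s := by
      simpa using (hasDerivAt_id s).mul_const (h' 0)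
    have h2 : HasDerivAt (fun s : ℝ => M * s ^ 2 / 2) (M * s) s := by
      have h2' : HasDerivAt (fun s : ℝ => s ^ 2) (2 * s) s := by simpa using hasDerivAt_pow 2 s
      exact ((h2'.const_mul M).div_const 2).congr_deriv (by ring)
    exact ((hd s hs).sub h1).add h2
  have hmono : MonotoneOn (fun s => h s - s * h' 0 + M * s ^ 2 / 2) (Icc 0 l) :=
    monotoneOn_of_hasDerivWithinAt_nonneg (convex_Icc 0 l)
      (fun s hs => (hgd s hs).continuousAt.continuousWithinAt)
      (fun s hs => (hgd s (interior_subset hs)).hasDerivWithinAt)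
      (fun s hs => by
        rw [interior_Icc] at hs
        have := hLip s (Ioo_subset_Icc_self hs)
        linarith)
  have key := hmono (left_mem_Icc.mpr hl) (right_mem_Icc.mpr hl) hl
  simp only at key
  norm_num at key
  linarith

/-- Two-sided second-order Taylor bounds at BOTH ends of the symmetric window `[−l, l]` from the two-sided Lipschitz bound
`|h' s − h' 0| ≤ M·|s|`: `|h l − h 0 − l·h' 0| ≤ M·l²∕2` and `|h (−l) − h 0 + l·h' 0| ≤ M·l²∕2` (the second by reflection
`s ↦ h (−s)`). [folklore] -/
theorem abs_taylor_two_centre_le (hl : 0 ≤ l) (hd : ∀ s ∈ Icc (-l) l, HasDerivAt h (h' s) s)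
    (hLip : ∀ s ∈ Icc (-l) l, |h' s - h' 0| ≤ M * |s|) :
    |h l - h 0 - l * h' 0| ≤ M * l ^ 2 / 2 ∧ |h (-l) - h 0 + l * h' 0| ≤ M * l ^ 2 / 2 := by
  have hsub : Icc (0 : ℝ) l ⊆ Icc (-l) l := Icc_subset_Icc (by linarith) le_rfl
  have hLip' : ∀ s ∈ Icc (0 : ℝ) l, -(M * s) ≤ h' s - h' 0 ∧ h' s - h' 0 ≤ M * s := fun s hs => by
    have h1 := hLip s (hsub hs)
    rw [abs_of_nonneg hs.1] at h1
    exact abs_le.mp h1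
  refine ⟨abs_le.mpr ⟨taylor_two_lower hl (fun s hs => hd s (hsub hs)) fun s hs => (hLip' s hs).1,
    taylor_two_upper hl (fun s hs => hd s (hsub hs)) fun s hs => (hLip' s hs).2⟩, ?_⟩
  -- reflection
  have hkd : ∀ s ∈ Icc (0 : ℝ) l, HasDerivAt (fun s => h (-s)) (-h' (-s)) s := by
    intro s hs
    have hs' : -s ∈ Icc (-l) l := ⟨by linarith [hs.2], by linarith [hs.1]⟩
    have := (hd (-s) hs').comp s (hasDerivAt_neg s)
    simpa [Function.comp_def] using this
  have hkLip : ∀ s ∈ Icc (0 : ℝ) l, -(M * s) ≤ -h' (-s) - -h' (-0) ∧ -h' (-s) - -h' (-0) ≤ M * s := fun s hs => by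
    have hs' : -s ∈ Icc (-l) l := ⟨by linarith [hs.2], by linarith [hs.1]⟩
    have h1 := hLip (-s) hs'
    rw [abs_neg, abs_of_nonneg hs.1] at h1
    rw [neg_zero]
    constructor <;> linarith [(abs_le.mp h1).1, (abs_le.mp h1).2]
  have hlo := taylor_two_lower hl hkd fun s hs => (hkLip s hs).1
  have hup := taylor_two_upper hl hkd fun s hs => (hkLip s hs).2
  simp only [neg_zero] at hlo hup
  rw [abs_le]
  constructor <;> linarith

/-- **LANDAU's INEQUALITY AT THE CENTRE OF A SYMMETRIC WINDOW.**  If `h` has derivative `h'` on `[−l, l]` (`0 < l`), `h'` is within `M·|s|` of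
`h' 0`, and `|h t − h 0| ≤ η` on the window, then `|h' 0| ≤ η∕l + M·l∕2` — subtract the two second-order Taylor identities at `±l`: the centre
value and the even part cancel. [folklore] -/
theorem abs_deriv_centre_le (hl : 0 < l) (hd : ∀ s ∈ Icc (-l) l, HasDerivAt h (h' s) s)
    (hLip : ∀ s ∈ Icc (-l) l, |h' s - h' 0| ≤ M * |s|) (hη : ∀ t ∈ Icc (-l) l, |h t - h 0| ≤ η) :
    |h' 0| ≤ η / l + M * l / 2 := by
  obtain ⟨h1, h2⟩ := abs_taylor_two_centre_le hl.le hd hLip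
  have e1 := hη l ⟨by linarith, le_rfl⟩
  have e2 := hη (-l) ⟨le_rfl, by linarith⟩
  have key : |h' 0| * (2 * l) ≤ 2 * η + M * l ^ 2 := by
    have e : h' 0 * (2 * l) =
        (h l - h 0) - (h (-l) - h 0) - (h l - h 0 - l * h' 0) + (h (-l) - h 0 + l * h' 0) := by ring
    rw [← abs_of_pos (by positivity : (0 : ℝ) < 2 * l), ← abs_mul, e]
    rw [abs_le] at h1 h2 e1 e2 ⊢
    constructor <;> linarith [h1.1, h1.2, h2.1, h2.2, e1.1, e1.2, e2.1, e2.2]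
  have hl' : l ≠ 0 := hl.ne'
  calc |h' 0| ≤ (2 * η + M * l ^ 2) / (2 * l) := (le_div_iff₀ (by positivity)).mpr key
    _ = η / l + M * l / 2 := by field_simp

/-- The arithmetic of the optimal window: if `x ≤ η∕l' + M·l'∕2` for EVERY `0 < l' ≤ l` (`0 ≤ η`, `0 ≤ M`, `0 < l`), then
`x ≤ 2η∕l + √(2ηM)` (window `l' = min (l, √(2η∕M))`; the cases `η = 0` ∕ `M = 0` by a limiting ∕ direct choice). [folklore] -/
theorem window_optimum {x : ℝ} (hη : 0 ≤ η) (hM : 0 ≤ M) (hl : 0 < l)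
    (hx : ∀ l', 0 < l' → l' ≤ l → x ≤ η / l' + M * l' / 2) : x ≤ 2 * η / l + Real.sqrt (2 * η * M) := by
  have hs0 : 0 ≤ Real.sqrt (2 * η * M) := Real.sqrt_nonneg _
  have hηl : 0 ≤ η / l := div_nonneg hη hl.le
  have h2ηl : 2 * η / l = η / l + η / l := by ring
  rcases eq_or_lt_of_le hη with hη0 | hηpos
  · -- η = 0: x ≤ M l'/2 for all small l' forces x ≤ 0
    subst hη0
    have hx0 : x ≤ 0 := by
      refine le_of_forall_pos_le_add fun ε hε => ?_
      set l' := min l (2 * ε / (M + 1)) with hl'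
      have hM1 : 0 < M + 1 := by linarith
      have hl'pos : 0 < l' := lt_min hl (by positivity)
      have := hx l' hl'pos (min_le_left _ _)
      have hl'le : l' ≤ 2 * ε / (M + 1) := min_le_right _ _
      have hb : M * l' / 2 ≤ ε := by
        calc M * l' / 2 ≤ M * (2 * ε / (M + 1)) / 2 := by gcongr
          _ = ε * (M / (M + 1)) := by field_simp
          _ ≤ ε * 1 := by gcongr; exact (div_le_one hM1).mpr (by linarith)
          _ = ε := mul_one ε
      simp only [zero_div, zero_add] at this
      linarith
    have : Real.sqrt (2 * 0 * M) = 0 := by simp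
    rw [this]
    simp only [mul_zero, zero_div, add_zero]
    exact hx0
  rcases eq_or_lt_of_le hM with hM0 | hMpos
  · -- M = 0
    subst hM0
    have := hx l hl le_rfl
    simp only [zero_mul, zero_div, add_zero] at this
    linarith
  -- η > 0, M > 0
  set s := Real.sqrt (2 * η * M) with hs
  have h2ηM : 0 < 2 * η * M := by positivity
  have hspos : 0 < s := Real.sqrt_pos.mpr h2ηM
  have hss : s * s = 2 * η * M := Real.mul_self_sqrt h2ηM.le
  set r := 2 * η / s with hr
  have hrpos : 0 < r := by positivity
  have hr1 : η / r = s / 2 := by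
    rw [hr]
    field_simp
  have hr2 : M * r / 2 = s / 2 := by
    rw [hr, div_eq_div_iff (by norm_num : (2 : ℝ) ≠ 0) (by norm_num : (2 : ℝ) ≠ 0)]
    field_simp
    nlinarith [hss]
  rcases le_or_gt r l with hrl | hlr
  · have := hx r hrpos hrl
    rw [hr1, hr2] at this
    linarith
  · have := hx l hl le_rfl
    have hMl : M * l / 2 ≤ s / 2 := by
      rw [← hr2]
      gcongr
    linarith

/-- **LANDAU, OPTIMISED OVER THE WINDOW**: under the hypotheses of `abs_deriv_centre_le` on `[−l, l]` with `0 ≤ M`,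
`|h' 0| ≤ 2η∕l + √(2ηM)` (apply `abs_deriv_centre_le` on every sub-window `[−l', l']` and `window_optimum`). [folklore] -/
theorem abs_deriv_centre_le_sqrt (hl : 0 < l) (hM : 0 ≤ M) (hd : ∀ s ∈ Icc (-l) l, HasDerivAt h (h' s) s)
    (hLip : ∀ s ∈ Icc (-l) l, |h' s - h' 0| ≤ M * |s|) (hη : ∀ t ∈ Icc (-l) l, |h t - h 0| ≤ η) :
    |h' 0| ≤ 2 * η / l + Real.sqrt (2 * η * M) := by
  have hη0 : 0 ≤ η := (abs_nonneg _).trans (hη 0 ⟨by linarith, hl.le⟩)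
  refine window_optimum hη0 hM hl fun l' hl' hl'l => ?_
  have hsub : Icc (-l') l' ⊆ Icc (-l) l := Icc_subset_Icc (by linarith) hl'l
  exact abs_deriv_centre_le hl' (fun s hs => hd s (hsub hs)) (fun s hs => hLip s (hsub hs)) fun t ht => hη t (hsub ht)

end Landau

/-! ## §2 Two `C²` functions with second derivatives in `[0, V]` and matched increments [folklore] -/

section Matched

variable {f g f' g' f'' g'' : ℝ → ℝ} {η V l : ℝ}

/-- **MATCHED INCREMENTS ⇒ MATCHED DERIVATIVES AT THE CENTRE, AT THE PRICE √.**  If `f`, `g` are twice differentiable on `[−l, l]`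
(`0 < l`) with second derivatives in `[0, V]` (two «variances»), and their increments from the centre agree within `η`,
`|(g t − g 0) − (f t − f 0)| ≤ η` on the window, then `|g' 0 − f' 0| ≤ 2η∕l + √(2ηV)` — Landau for `h = g − f`, whose second
derivative is a difference of two numbers in `[0, V]`, so `|h″| ≤ V` with NO smallness. [folklore] -/
theorem abs_sub_deriv_le_of_matched_increments (hl : 0 < l) (hV : 0 ≤ V)
    (hf : ∀ s ∈ Icc (-l) l, HasDerivAt f (f' s) s) (hf' : ∀ s ∈ Icc (-l) l, HasDerivAt f' (f'' s) s)
    (hg : ∀ s ∈ Icc (-l) l, HasDerivAt g (g' s) s) (hg' : ∀ s ∈ Icc (-l) l, HasDerivAt g' (g'' s) s)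
    (hf'' : ∀ s ∈ Icc (-l) l, f'' s ∈ Icc 0 V) (hg'' : ∀ s ∈ Icc (-l) l, g'' s ∈ Icc 0 V)
    (hη : ∀ t ∈ Icc (-l) l, |(g t - g 0) - (f t - f 0)| ≤ η) :
    |g' 0 - f' 0| ≤ 2 * η / l + Real.sqrt (2 * η * V) := by
  have hd : ∀ s ∈ Icc (-l) l, HasDerivAt (fun s => g s - f s) (g' s - f' s) s :=
    fun s hs => (hg s hs).sub (hf s hs)
  have hLip : ∀ s ∈ Icc (-l) l, |(g' s - f' s) - (g' 0 - f' 0)| ≤ V * |s| := by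
    intro s hs
    have hderiv : ∀ x ∈ Icc (-l) l,
        HasDerivWithinAt (fun s => g' s - f' s) (g'' x - f'' x) (Icc (-l) l) x :=
      fun x hx => ((hg' x hx).sub (hf' x hx)).hasDerivWithinAt
    have hbound : ∀ x ∈ Icc (-l) l, ‖g'' x - f'' x‖ ≤ V := fun x hx => by
      rw [Real.norm_eq_abs, abs_le]
      constructor <;> linarith [(hf'' x hx).1, (hf'' x hx).2, (hg'' x hx).1, (hg'' x hx).2]
    have h0 : (0 : ℝ) ∈ Icc (-l) l := ⟨by linarith, hl.le⟩
    have := (convex_Icc (-l) l).norm_image_sub_le_of_norm_hasDerivWithin_le hderiv hbound h0 hs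
    simpa [Real.norm_eq_abs] using this
  have hη' : ∀ t ∈ Icc (-l) l, |(g t - f t) - (g 0 - f 0)| ≤ η := fun t ht => by
    have e : (g t - f t) - (g 0 - f 0) = (g t - g 0) - (f t - f 0) := by ring
    rw [e]
    exact hη t ht
  exact abs_deriv_centre_le_sqrt hl hV hd hLip hη'

end Matched

/-! ## §3 At Mathlib's cumulant generating function of a bounded variable [folklore] -/

section Cgf

variable {Ω : Type*} {mΩ : MeasurableSpace Ω} {μ : Measure Ω} [IsProbabilityMeasure μ] {X : Ω → ℝ} {B : ℝ}

/-- **THE SECOND DERIVATIVE OF A CUMULANT GENERATING FUNCTION IS A TILTED VARIANCE: `0 ≤ cgf″ ≤ B²`** for a variable bounded by `B`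
under a probability measure (Mathlib `iteratedDeriv_two_cgf_eq_integral` ∕ `iteratedDeriv_two_cgf`; the upper bound drops the square of
the tilted mean and bounds `X² ≤ B²`). [folklore] -/
theorem iteratedDeriv_two_cgf_mem_Icc (hX : AEMeasurable X μ) (hB : ∀ᵐ ω ∂μ, |X ω| ≤ B) (t : ℝ) :
    iteratedDeriv 2 (cgf X μ) t ∈ Icc 0 (B ^ 2) := by
  have ht := T4GenFunBounds.mem_interior_integrableExpSet hX hB t
  have hint : Integrable (fun ω => Real.exp (t * X ω)) μ := interior_subset (s := integrableExpSet X μ) ht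
  have hpos : 0 < mgf X μ t := mgf_pos' (IsProbabilityMeasure.ne_zero μ) hint
  constructor
  · rw [iteratedDeriv_two_cgf_eq_integral ht]
    exact div_nonneg (integral_nonneg fun ω => mul_nonneg (sq_nonneg _) (Real.exp_nonneg _)) hpos.le
  · rw [iteratedDeriv_two_cgf ht]
    have h1 : μ[fun ω => X ω ^ 2 * Real.exp (t * X ω)] ≤ B ^ 2 * mgf X μ t := by
      rw [mgf, ← integral_const_mul]
      refine integral_mono_ae (integrable_pow_mul_exp_of_mem_interior_integrableExpSet ht 2) (hint.const_mul _) ?_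
      filter_upwards [hB] with ω hω
      exact mul_le_mul_of_nonneg_right (sq_le_sq' (abs_le.mp hω).1 (abs_le.mp hω).2) (Real.exp_nonneg _)
    calc μ[fun ω => X ω ^ 2 * Real.exp (t * X ω)] / mgf X μ t - deriv (cgf X μ) t ^ 2
        ≤ μ[fun ω => X ω ^ 2 * Real.exp (t * X ω)] / mgf X μ t := sub_le_self _ (sq_nonneg _)
      _ ≤ B ^ 2 := (div_le_iff₀ hpos).mpr h1

/-- The derivative of the cumulant generating function of a bounded variable is itself differentiable everywhere, with derivative
`iteratedDeriv 2 (cgf X μ)` (real-analyticity, `T4GenFunBounds.analyticAt_cgf_of_abs_le` BY NAME). [folklore] -/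
theorem hasDerivAt_deriv_cgf (hX : AEMeasurable X μ) (hB : ∀ᵐ ω ∂μ, |X ω| ≤ B) (t : ℝ) :
    HasDerivAt (deriv (cgf X μ)) (iteratedDeriv 2 (cgf X μ) t) t := by
  rw [iteratedDeriv_succ, iteratedDeriv_one]
  exact (T4GenFunBounds.analyticAt_cgf_of_abs_le hX hB t).deriv.differentiableAt.hasDerivAt

/-- **TWO BOUNDED VARIABLES WITH MATCHED NORMALISED CUMULANT GENERATING FUNCTIONS HAVE MATCHED MEANS, AT THE PRICE √.**  `X` on
`(Ω, μ)` and `Y` on `(Ω', ν)` (probability measures), both bounded by `B`; if `|(cgf Y ν t − cgf Y ν 0) − (cgf X μ t − cgf X μ 0)| ≤ η`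
on `[−l, l]` (`0 < l`), then `|(cgf Y ν)′ 0 − (cgf X μ)′ 0| ≤ 2η∕l + √(2ηB²)` — §2 with `V = B²` by `iteratedDeriv_two_cgf_mem_Icc`.
(`(cgf X μ)′ 0 = ∫ X dμ`: Mathlib `deriv_cgf_zero`, tree `T4GenFunBounds.deriv_cgf_zero_of_abs_le`.) [folklore] -/
theorem abs_sub_deriv_cgf_zero_le {Ω' : Type*} {mΩ' : MeasurableSpace Ω'} {ν : Measure Ω'} [IsProbabilityMeasure ν]
    {Y : Ω' → ℝ} (hX : AEMeasurable X μ) (hBX : ∀ᵐ ω ∂μ, |X ω| ≤ B) (hY : AEMeasurable Y ν)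
    (hBY : ∀ᵐ ω ∂ν, |Y ω| ≤ B) {η l : ℝ} (hl : 0 < l)
    (hη : ∀ t ∈ Icc (-l) l, |(cgf Y ν t - cgf Y ν 0) - (cgf X μ t - cgf X μ 0)| ≤ η) :
    |deriv (cgf Y ν) 0 - deriv (cgf X μ) 0| ≤ 2 * η / l + Real.sqrt (2 * η * B ^ 2) :=
  abs_sub_deriv_le_of_matched_increments hl (sq_nonneg B)
    (fun s _ => (T4GenFunBounds.differentiable_cgf_of_abs_le hX hBX s).hasDerivAt)
    (fun s _ => hasDerivAt_deriv_cgf hX hBX s)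
    (fun s _ => (T4GenFunBounds.differentiable_cgf_of_abs_le hY hBY s).hasDerivAt)
    (fun s _ => hasDerivAt_deriv_cgf hY hBY s)
    (fun s _ => iteratedDeriv_two_cgf_mem_Icc hX hBX s) (fun s _ => iteratedDeriv_two_cgf_mem_Icc hY hBY s) hη

end Cgf

/-! ## §4 The price √ is attained for the §2 class (kernel guard) [folklore] -/

section Witness

/-- **THE √ IS NOT AN ARTEFACT OF THE PROOF.**  For `0 < η`, `0 < M` put `ω = √(M∕η)`, `f t = M·t²∕4 − (η∕2)·sin(ω t)`,
`g t = M·t²∕4 + (η∕2)·sin(ω t)`: both are `C²` on ℝ with second derivatives `M∕2 ∓ (M∕2)·sin(ω t) ∈ [0, M]` (two admissible «variance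
profiles»), their increments from the centre agree within `η` on EVERY window (`(g t − g 0) − (f t − f 0) = η·sin(ω t)`), and yet
`g′ 0 − f′ 0 = η·ω = √(ηM)` — so no bound better than `√(ηM)` holds for the class of `abs_sub_deriv_le_of_matched_increments`, whose bound
tends to `√(2ηM)` as the window grows. [folklore] -/
theorem sqrt_price_witness {η M : ℝ} (hη : 0 < η) (hM : 0 < M) :
    ∃ f g f' g' f'' g'' : ℝ → ℝ,
      (∀ s, HasDerivAt f (f' s) s) ∧ (∀ s, HasDerivAt f' (f'' s) s) ∧
      (∀ s, HasDerivAt g (g' s) s) ∧ (∀ s, HasDerivAt g' (g'' s) s) ∧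
      (∀ s, f'' s ∈ Icc 0 M) ∧ (∀ s, g'' s ∈ Icc 0 M) ∧
      (∀ t, |(g t - g 0) - (f t - f 0)| ≤ η) ∧ g' 0 - f' 0 = Real.sqrt (η * M) := by
  set ω := Real.sqrt (M / η) with hω
  have hω0 : 0 ≤ ω := by rw [hω]; exact Real.sqrt_nonneg _
  have hω2 : ω ^ 2 = M / η := by rw [hω]; exact Real.sq_sqrt (by positivity)
  have hηω2 : η * ω ^ 2 = M := by rw [hω2]; field_simp
  -- elementary derivatives
  have hq : ∀ s : ℝ, HasDerivAt (fun t : ℝ => M * t ^ 2 / 4) (M * s / 2) s := fun s => by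
    have h2' : HasDerivAt (fun t : ℝ => t ^ 2) (2 * s) s := by simpa using hasDerivAt_pow 2 s
    exact ((h2'.const_mul M).div_const 4).congr_deriv (by ring)
  have hlin : ∀ s : ℝ, HasDerivAt (fun t : ℝ => M * t / 2) (M / 2) s := fun s =>
    (((hasDerivAt_id s).const_mul M).div_const 2).congr_deriv (by simp)
  have hsin : ∀ s : ℝ, HasDerivAt (fun t : ℝ => Real.sin (ω * t)) (ω * Real.cos (ω * s)) s := fun s =>
    ((Real.hasDerivAt_sin (ω * s)).comp s ((hasDerivAt_id s).const_mul ω)).congr_deriv (by simp [mul_comm])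
  have hcos : ∀ s : ℝ, HasDerivAt (fun t : ℝ => ω * Real.cos (ω * t)) (-(ω ^ 2 * Real.sin (ω * s))) s := fun s =>
    (((Real.hasDerivAt_cos (ω * s)).comp s ((hasDerivAt_id s).const_mul ω)).const_mul ω).congr_deriv (by
      simp only [mul_one]; ring)
  have hsin1 : ∀ x : ℝ, Real.sin x ≤ 1 := Real.sin_le_one
  have hsin2 : ∀ x : ℝ, -1 ≤ Real.sin x := Real.neg_one_le_sin
  refine ⟨fun t => M * t ^ 2 / 4 - η / 2 * Real.sin (ω * t), fun t => M * t ^ 2 / 4 + η / 2 * Real.sin (ω * t),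
    fun t => M * t / 2 - η / 2 * (ω * Real.cos (ω * t)), fun t => M * t / 2 + η / 2 * (ω * Real.cos (ω * t)),
    fun t => M / 2 - η / 2 * -(ω ^ 2 * Real.sin (ω * t)), fun t => M / 2 + η / 2 * -(ω ^ 2 * Real.sin (ω * t)),
    fun s => (hq s).sub ((hsin s).const_mul (η / 2)), fun s => (hlin s).sub ((hcos s).const_mul (η / 2)),
    fun s => (hq s).add ((hsin s).const_mul (η / 2)), fun s => (hlin s).add ((hcos s).const_mul (η / 2)),
    fun s => ?_, fun s => ?_, fun t => ?_, ?_⟩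
  · have e : η / 2 * -(ω ^ 2 * Real.sin (ω * s)) = -(M / 2 * Real.sin (ω * s)) := by rw [← hηω2]; ring
    simp only [e, mem_Icc]
    constructor <;> nlinarith [hsin1 (ω * s), hsin2 (ω * s)]
  · have e : η / 2 * -(ω ^ 2 * Real.sin (ω * s)) = -(M / 2 * Real.sin (ω * s)) := by rw [← hηω2]; ring
    simp only [e, mem_Icc]
    constructor <;> nlinarith [hsin1 (ω * s), hsin2 (ω * s)]
  · have e : (M * t ^ 2 / 4 + η / 2 * Real.sin (ω * t) - (M * 0 ^ 2 / 4 + η / 2 * Real.sin (ω * 0))) -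
        (M * t ^ 2 / 4 - η / 2 * Real.sin (ω * t) - (M * 0 ^ 2 / 4 - η / 2 * Real.sin (ω * 0))) =
        η * Real.sin (ω * t) := by
      simp only [mul_zero, Real.sin_zero]
      ring
    rw [e, abs_mul, abs_of_pos hη]
    exact mul_le_of_le_one_right hη.le (Real.abs_sin_le_one _)
  · have key : Real.sqrt (η * M) = η * ω := by
      rw [Real.sqrt_eq_iff_mul_self_eq (by positivity) (mul_nonneg hη.le hω0)]
      have : η * ω * (η * ω) = η * (η * ω ^ 2) := by ring
      rw [this, hηω2]
    show (M * 0 / 2 + η / 2 * (ω * Real.cos (ω * 0))) - (M * 0 / 2 - η / 2 * (ω * Real.cos (ω * 0))) = Real.sqrt (η * M)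
    simp only [mul_zero, Real.cos_zero, mul_one, zero_div]
    rw [key]
    ring

end Witness

end Summit.QuantumFields.YangMills.BalabanUVNodes.N19ExpectationCurrency

end
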